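import Literature.MathematicalPhysics.QuantumFieldTheory.YangMillsOS
import Literature.MathematicalPhysics.QuantumFieldTheory.TiltedTorusSwapRP
import HarnessLib

/-!
# Wilson's lattice gauge theory on the Fröhlich–Israel–Lieb–Simon 45° torus: the concrete volume,
# its swap reflection positivity, and the lattice Schwinger functions computed on it

The statement-level lattice Schwinger functions `latticeSchwinger` (`YangMillsOS.lean`) live on the hypercubic
periodic tori `ℤ⁴/Sℤ⁴`, `S = 2L_k+1`, of a `SpeciesScheme`.  Such tori carry the coordinate-plane mirrors but NO
diagonal mirror pair `x₀ = x₁ (+ const)` (square periodic tori are not swap reflection positive; FILS II §3: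
"the usual finite-volume cutoffs destroy this reflection positivity … one must use a periodic box with sides at
45°").  The boundaryless volume that IS swap reflection positive for Wilson's action is the FILS 45° torus

  `T̃_N = ℤ⁴ / Λ̃_N`,  `Λ̃_N = ⟨N(e₀+e₁), N(e₀−e₁), N e₂, N e₃⟩`  (a 2:1 cover of `ℤ⁴/Nℤ⁴`),

which in the sheared chart `(u, w, y, z) = (x₀ − x₁, x₁, x₂, x₃)` is the product `ℤ_{2N} × ℤ_N × ℤ_N × ℤ_N` with
steps `e₀ = (1,0,0,0)`, `e₁ = (−1,1,0,0)`, `e₂`, `e₃`, the swap `x₀ ↔ x₁` acting as `(u,w,y,z) ↦ (−u, w+ū, y, z)`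
(`ū = u mod N`; it fixes the two mirror layers `u = 0`, `u = N` pointwise and exchanges `e₀ ↔ e₁`).

This file gives that volume NAMES (namespace `TiltedTorus`): sites/edges/configurations, steps, plaquette
holonomy, Wilson's action `∑ₓ ∑_{i<j} Re tr ρ(U_{x,ij})`, the Boltzmann weight, product Haar measure, partition
function and normalised expectation, the swap on sites/edges/configurations, the closed positive half, the
reduction `ℤ⁴ → T̃_N` and the periodic lift of configurations; then
* `TiltedTorus.integral_conj_swap_mul_weight_nonneg`, `TiltedTorus.expect_conj_swap_mul_nonneg` — swap reflection
  positivity of Wilson's measure on `T̃_N` for `β ≥ 0`, `N ≥ 2` (the definition-free Literature theorem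
  `TiltedTorusRP.integral_conj_swap_mul_nonneg`, FILS 1978 Thm 2.1 in the tilted geometry, instantiated by `rfl`);
* `tiltedLatticeSchwinger ρ sch obs k n σ f` — the joint lattice `n`-point function of a species string at step `k`
  of a scheme computed on the cover `T̃_{2L_k+1}` instead of the torus `ℤ⁴/(2L_k+1)ℤ⁴` (same smearing box
  `[-L_k, L_k]⁴ ⊂ ℤ⁴`, spacing, coupling and renormalisations as `latticeSchwinger`), so that route statements can
  quote lattice convergence / boundary-condition insensitivity ON THE COVERS (the finite-size input any transport of
  diagonal reflection positivity to a continuum limit needs).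

Design: `d = 4` throughout (the only case used); the normalisation of the action is the tree's (`exp(β · ∑ Re tr)`,
equal to `wilsonMeasure`'s `exp(−β ∑ (N − Re tr))` up to a constant that cancels in expectations).  The summit-side
crux files of `DiagonalMirrorRPR` (`Summits/QuantumFields/YangMills/Theorems/PencilRigidityDiagonalMirrorRPRStubRpClosureDefs.lean`,
2026-08-16) carry a verbatim copy of this vocabulary (`TSite (2*N) N N`, `tstep true`, `texp`, `skewLift`,
`coverSchwinger`) that predates its Literature home; the types agree definitionally, so users bridge by `rfl`.
Deliberately NOT here: transfer matrices / twisted traces of the cover (Lüscher 1977; Giusti–Meyer shifted boundary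
conditions), and any comparison theorem between `latticeSchwinger` and `tiltedLatticeSchwinger` (none is known in
print beyond strong coupling).

References: J. Fröhlich, R. Israel, E. H. Lieb, B. Simon, Comm. Math. Phys. 62 (1978) 1, Thm. 2.1 [FILS1978] and
J. Stat. Phys. 22 (1980) 297, §3 [FrohlichIsraelLiebSimon1980]; K. Osterwalder, E. Seiler, Ann. Phys. 110 (1978) 440,
§2 [OsterwalderSeiler1978]; K. Wilson, Phys. Rev. D 10 (1974) 2445 [Wilson1974]; A. Jaffe, E. Witten (Clay 2000) §6
[JaffeWitten2000].
-/

noncomputable section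

open scoped SchwartzMap ComplexConjugate ComplexOrder
open MeasureTheory Filter Topology
open Literature.MathematicalPhysics.QuantumLattice Literature.Probability.LatticeModels

namespace Literature.MathematicalPhysics.QuantumFieldTheory

namespace TiltedTorus

/-! ## The volume `T̃_N` in the sheared chart -/

/-- Sites of the 45° torus `T̃_N` in the chart `(u,w,y,z) = (x₀−x₁, x₁, x₂, x₃)`: `ℤ_{2N} × ℤ_N × ℤ_N × ℤ_N`.
[cite: FrohlichIsraelLiebSimon1980, §3] -/
abbrev Site (N : ℕ) : Type := ZMod (2 * N) × ZMod N × ZMod N × ZMod N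

/-- Positively oriented edges `(x, i)` of `T̃_N`: from `x` to `x + step i`. [cite: FrohlichIsraelLiebSimon1980, §3] -/
abbrev Edge (N : ℕ) : Type := Site N × Fin 4

/-- Lattice gauge configurations on `T̃_N`: a group element per positively oriented edge. [cite: Wilson1974] -/
abbrev Config (N : ℕ) (G : Type*) : Type _ := Edge N → G

/-- `2N ≠ 0` when `N ≠ 0`. [folklore] -/
instance neZero_two_mul (N : ℕ) [NeZero N] : NeZero (2 * N) := ⟨mul_ne_zero two_ne_zero (NeZero.ne N)⟩

variable {N : ℕ}

/-- The four steps in the sheared chart: `e₀ = (1,0,0,0)`, `e₁ = (−1,1,0,0)`, `e₂ = (0,0,1,0)`, `e₃ = (0,0,0,1)`.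
[cite: FrohlichIsraelLiebSimon1980, §3] -/
def step (i : Fin 4) : Site N :=
  ![((1 : ZMod (2 * N)), (0 : ZMod N), (0 : ZMod N), (0 : ZMod N)),
    ((-1 : ZMod (2 * N)), (1 : ZMod N), (0 : ZMod N), (0 : ZMod N)),
    ((0 : ZMod (2 * N)), (0 : ZMod N), (1 : ZMod N), (0 : ZMod N)),
    ((0 : ZMod (2 * N)), (0 : ZMod N), (0 : ZMod N), (1 : ZMod N))] i

variable {G : Type*} [Group G]

/-- Plaquette holonomy `U(x,i) U(x+eᵢ,j) U(x+eⱼ,i)⁻¹ U(x,j)⁻¹` on `T̃_N`. [cite: Wilson1974] -/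
def plaq (U : Config N G) (x : Site N) (i j : Fin 4) : G :=
  U (x, i) * U (x + step i, j) * (U (x + step j, i))⁻¹ * (U (x, j))⁻¹

variable {Nc : ℕ} (ρ : G →* Matrix (Fin Nc) (Fin Nc) ℂ)

/-- Wilson's action `∑ₓ ∑_{i<j} Re tr ρ(U_{x,ij})` on `T̃_N` (tree normalisation: the Boltzmann weight is
`exp(β · action)`). [cite: Wilson1974] -/
def action [NeZero N] (U : Config N G) : ℝ :=
  ∑ x : Site N, ∑ i : Fin 4, ∑ j : Fin 4, if i < j then (ρ (plaq U x i j)).trace.re else 0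

/-- Boltzmann weight `exp(β · action)`. [cite: Wilson1974] -/
def weight [NeZero N] (β : ℝ) (U : Config N G) : ℝ :=
  Real.exp (β * action ρ U)

variable [TopologicalSpace G] [IsTopologicalGroup G] [CompactSpace G] [MeasurableSpace G] [BorelSpace G]

/-- Product of normalised Haar measures over the edges of `T̃_N`. [cite: OsterwalderSeiler1978, §2] -/
def haar (N : ℕ) [NeZero N] : Measure (Config N G) :=
  Measure.pi fun _ : Edge N => haarProbability G

/-- Partition function `Z = ∫ exp(β · action) dHaar` of Wilson's theory on `T̃_N`. [cite: OsterwalderSeiler1978, §2] -/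
def Z (N : ℕ) [NeZero N] (β : ℝ) : ℝ :=
  ∫ U, weight ρ β U ∂(haar N : Measure (Config N G))

/-- Normalised (complex) expectation `⟨F⟩ = Z⁻¹ ∫ F exp(β · action) dHaar` of Wilson's theory on `T̃_N`.
[cite: OsterwalderSeiler1978, §2] -/
def expect [NeZero N] (β : ℝ) (F : Config N G → ℂ) : ℂ :=
  (∫ U, F U * ((weight ρ β U : ℝ) : ℂ) ∂(haar N : Measure (Config N G))) / ((Z ρ N β : ℝ) : ℂ)

/-! ## The swap reflection `x₀ ↔ x₁` -/

/-- The swap `x₀ ↔ x₁` on sites, in the chart: `(u, w, y, z) ↦ (−u, w + ū, y, z)`, `ū = u mod N`; it fixes the layers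
`u = 0` and `u = N` pointwise. [cite: FILS1978, Thm 2.1] -/
def swapSite (x : Site N) : Site N :=
  (-x.1, x.2.1 + ZMod.castHom (dvd_mul_left N 2) (ZMod N) x.1, x.2.2.1, x.2.2.2)

/-- The induced map on positively oriented edges (orientation preserved): `(x, i) ↦ (swap x, σ i)`, `σ = (0 1)`.
[cite: FILS1978, Thm 2.1] -/
def swapEdge (e : Edge N) : Edge N :=
  (swapSite e.1, Equiv.swap (0 : Fin 4) 1 e.2)

/-- The swap on configurations, `θ^*U = U ∘ swapEdge`. [cite: FILS1978, Thm 2.1] -/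
def swapConfig {G : Type*} (U : Config N G) : Config N G := U ∘ swapEdge

/-- Edges of the CLOSED positive half `0 ≤ u ≤ N` (both endpoints between the two mirror layers).
[cite: FILS1978, Thm 2.1] -/
def posEdges (N : ℕ) [NeZero N] : Set (Edge N) :=
  {e | (e.1.1).val ≤ N ∧ ((e.1 + step e.2).1).val ≤ N}

/-! ## `T̃_N` as a quotient of `ℤ⁴`: reduction and periodic lift -/

/-- Reduction of `ℤ⁴` modulo `Λ̃_N = ⟨N(e₀+e₁), N(e₀−e₁), Ne₂, Ne₃⟩` in the chart `(u,w) = (x₀−x₁, x₁)`: a map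
`ℤ⁴ → ℤ_{2N} × ℤ_N × ℤ_N²` with fibres the `Λ̃_N`-cosets, `e₀ ↦ (1,0,0,0)`, `e₁ ↦ (−1,1,0,0)`.
[cite: FrohlichIsraelLiebSimon1980, §3] -/
def proj (N : ℕ) (x : Fin 4 → ℤ) : Site N :=
  (((x 0 - x 1 : ℤ) : ZMod (2 * N)), ((x 1 : ℤ) : ZMod N), ((x 2 : ℤ) : ZMod N), ((x 3 : ℤ) : ZMod N))

/-- The `Λ̃_N`-periodic lift of a cover configuration to a configuration of `ℤ⁴` (the analogue of `torusLift`).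
[cite: FrohlichIsraelLiebSimon1980, §3] -/
def lift (N : ℕ) {G : Type*} (U : Config N G) : LGConfig 4 G := fun e => U (proj N e.1, e.2)

/-! ## Swap reflection positivity of Wilson's measure on `T̃_N` -/

/-- **Swap reflection positivity on the 45° torus (un-normalised).** For a compact group `G`, a continuous unitary
matrix representation `ρ`, `β ≥ 0`, `N ≥ 2` and every bounded measurable `F` depending only on the edges of the
closed half `0 ≤ u ≤ N`, `0 ≤ ∫ conj F(θ^*U) · F(U) · exp(β · action U) dHaar(U)` as a complex number — FILS 1978
Thm 2.1 in the tilted geometry of FILS II §3, i.e. the definition-free `TiltedTorusRP.integral_conj_swap_mul_nonneg`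
instantiated with this file's vocabulary by `rfl`. [cite: FILS1978, Thm 2.1] -/
theorem integral_conj_swap_mul_weight_nonneg
    (hρ : Continuous ρ) (hu : ∀ g, ρ g ∈ Matrix.unitaryGroup (Fin Nc) ℂ) {β : ℝ} (hβ : 0 ≤ β) [NeZero N]
    (hN : 2 ≤ N) {F : Config N G → ℂ} (hF : Measurable F) {C : ℝ} (hFb : ∀ U, ‖F U‖ ≤ C)
    (hFdep : DependsOn F (posEdges N)) :
    0 ≤ ∫ U, conj (F (swapConfig U)) * F U * ((weight ρ β U : ℝ) : ℂ) ∂(haar N : Measure (Config N G)) :=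
  TiltedTorusRP.integral_conj_swap_mul_nonneg ρ hρ hu hN step (by funext i; fin_cases i <;> simp [step])
    swapSite rfl swapEdge rfl swapConfig rfl plaq rfl (action ρ) rfl hβ (weight ρ β) rfl (haar N) rfl (posEdges N)
    (fun _ => Iff.rfl) hF hFb hFdep

/-- **Swap reflection positivity on the 45° torus (normalised expectation).** Under the same hypotheses the
normalised expectation `⟨conj(F ∘ θ^*) · F⟩_β` is real and non-negative (divide by the real number `Z ≥ 0`).
[cite: FILS1978, Thm 2.1] -/
theorem expect_conj_swap_mul_nonneg (hρ : Continuous ρ) (hu : ∀ g, ρ g ∈ Matrix.unitaryGroup (Fin Nc) ℂ)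
    {β : ℝ} (hβ : 0 ≤ β) [NeZero N] (hN : 2 ≤ N) {F : Config N G → ℂ} (hF : Measurable F) {C : ℝ}
    (hFb : ∀ U, ‖F U‖ ≤ C) (hFdep : DependsOn F (posEdges N)) :
    0 ≤ (expect ρ β fun U => conj (F (swapConfig U)) * F U).re ∧
      (expect ρ β fun U => conj (F (swapConfig U)) * F U).im = 0 := by
  have hI := integral_conj_swap_mul_weight_nonneg ρ hρ hu hβ hN hF hFb hFdep
  have hZ : 0 ≤ Z ρ N β := integral_nonneg fun U => (Real.exp_pos _).le
  obtain ⟨hre, him⟩ := Complex.nonneg_iff.1 hI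
  unfold expect
  rw [Complex.div_ofReal_re, Complex.div_ofReal_im]
  exact ⟨div_nonneg hre hZ, by rw [← him, zero_div]⟩

end TiltedTorus

/-! ## Lattice Schwinger functions of a scheme computed on the 45° covers -/

section Schwinger

variable {G : Type} [Group G] [MeasurableSpace G] [TopologicalSpace G] [IsTopologicalGroup G] [CompactSpace G]
  [BorelSpace G] {Nc : ℕ} {ι : Type}

/-- **Joint lattice `n`-point function of the species string `σ` at step `k`, computed on the 45° cover.** The
analogue of `latticeSchwinger` with the torus `ℤ⁴/(2L_k+1)ℤ⁴` replaced by its FILS double cover `T̃_{2L_k+1}`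
(Wilson's measure in the representation `ρ` at the scheme's coupling `β_k` on the cover; the same smeared, rescaled,
renormalised fields `Φ_{a_k}(fᵢ)` over the box `[-L_k, L_k]⁴ ⊂ ℤ⁴`, evaluated on the `Λ̃`-periodic lift):
`⟨∏ᵢ Φ^{σᵢ}_{a_k}(fᵢ)⟩_{T̃_{2L_k+1}, β_k}`.  Route statements use it to quote lattice convergence on the swap-RP
covers alongside `latticeSchwinger`. [cite: JaffeWitten2000, §6] -/
def tiltedLatticeSchwinger (ρ : G →* Matrix (Fin Nc) (Fin Nc) ℂ) (sch : SpeciesScheme ι)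
    (obs : ι → LGConfig 4 G → ℝ) (k : ℕ) (n : ℕ) (σ : Fin n → ι)
    (f : Fin n → 𝓢(EuclideanSpace ℝ (Fin 4), ℝ)) : ℝ :=
  (TiltedTorus.expect (N := sch.side k) ρ (sch.β k) fun U : TiltedTorus.Config (sch.side k) G =>
    ((∏ i, smearedLatticeField (obs (σ i)) (box 4 (sch.L k)) (sch.a k) (sch.c (σ i) k) (sch.m (σ i) k) (f i)
      (TiltedTorus.lift (sch.side k) U) : ℝ) : ℂ)).re

/-- With all multiplicative renormalisations zero (`c ≡ 0`, e.g. the degenerate scheme `SpeciesScheme.zero`) every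
tilted lattice `n`-point function with `n ≥ 1` vanishes, exactly as for `latticeSchwinger` (non-vacuity of clauses
quoting it). [folklore] -/
theorem tiltedLatticeSchwinger_eq_zero_of_c_eq_zero (ρ : G →* Matrix (Fin Nc) (Fin Nc) ℂ) (sch : SpeciesScheme ι)
    (hc : ∀ s k, sch.c s k = 0) (obs : ι → LGConfig 4 G → ℝ) (k : ℕ) {n : ℕ} (hn : n ≠ 0) (σ : Fin n → ι)
    (f : Fin n → 𝓢(EuclideanSpace ℝ (Fin 4), ℝ)) :
    tiltedLatticeSchwinger ρ sch obs k n σ f = 0 := by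
  obtain ⟨j, rfl⟩ := Nat.exists_eq_succ_of_ne_zero hn
  simp [tiltedLatticeSchwinger, smearedLatticeField, hc, TiltedTorus.expect]

end Schwinger

end Literature.MathematicalPhysics.QuantumFieldTheory

end
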